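import Literature.MathematicalPhysics.QuantumFieldTheory.Balaban1985CMP102.SectBLowerBound

/-!
# Bałaban CMP 102 (1985) 255–275, AS-PRINTED SPINE — `SectBRestricted`: the SMALL-FIELD-RESTRICTED densities (the
# «no large fields» term of (41) p. 266 as an object), their push-forward identity, the RESTRICTED READING of (41)/(47) as
# hypothesis-shaped `Prop`s, and the two-sided sandwich it yields on the doubly-small domain (its log-radius, the printed
# remainder `Σ_{j<k} O((L^jε)^{3+κ₀})|T₁^{(j)}|`, is sized in the sibling `SectBRemainder.lean`) — an ADDENDUM file
# (`SectB.lean`, `SectBLowerBound.lean` byte-stable; dot-notation extensions of `SectB.TowerObjects` declared from this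
# file of the same directory)

Source: T. Bałaban, *Ultraviolet stability of three-dimensional lattice pure gauge field theories*, Commun. Math. Phys.
**102** (1985) 255–275 [Balaban1985UV3] ([B10]; `paper:balaban1985-cmp102-uv-stability-3d`; PDF page = journal page −
254; locators `p. N Lm` = text-layer lines as in `Setting.lean`/`SectB.lean`).  [4] = [Balaban1985Averaging] (CMP 98),
[7] = [Balaban1985Variational] (CMP 102:277).

WHAT [B10] PRINTS.  (41) p. 266 L19–23 bounds the FULL density `ρ_k(V)` by a sum over large-field histories `{Ω_j}` of
restricted integrals times `exp[−(1/g_k²)A^η(U_k) + Σ_jΣ_{Y_j}𝒫_j(Y_j,U_k) − E_k + Σ_{j<k}O(log g_j^{−1})|Z_j| +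
Σ_{j<k}O((L^jε)^{3+κ₀})|T₁^{(j)}|]`; (47) p. 267 L17–20 bounds `ρ_k(V)` BELOW by the term of the history WITHOUT large
fields: «Analogously to (37) we assume the lower bound ρ_k(V) ≥ χ_k exp[−(1/g_k²)A^η(U_k) + Σ_{j=1}^k Σ_{Y_j} 𝒫_j(Y_j,U_k) −
E_k − Σ_{j=0}^{k−1} O((L^jε)^{3+κ₀})|T₁^{(j)}|]», proved (p. 272 L32–33) «in the same way, with all simplifications coming
from the fact that Ω_{k+1} = T_η», i.e. by DROPPING every contribution with a large field (all nonnegative) and running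
the small-field analysis on what is left.  The small-field characteristic functions print inserts step by step are
(40) p. 266 L15–18 «χ_j = Π_{p∈Λ_j} χ({|V_j(∂p) − 1| < 2L²g_{j−1}p(g_{j−1})}), j = 1, …, k, (40) where we have denoted
V_k = V.» (the (7) p. 257 L33–35 profile `p(g) = b₀(1 + log g^{−1})^{p₀}`).

WHAT THIS FILE ADDS (cell `ym3-torus`, seat p1 gen 2, task P1-5 of the cell's TARGET.md §4 «N6a restricted-density
reading of (41)/(47) as a theorem over `SectB.TowerObjects` (serves p2)»).  Nothing of `SectB.lean`/`SectBLowerBound.lean`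
changes; nothing of the paper is asserted.
§1 `TowerObjects.rhoRes W δ k` — THE RESTRICTED DENSITIES, DEFINED (not a binder): `ρ^res_0 = χ^δ_0·ρ₀`,
   `ρ^res_{k+1} = χ^δ_{k+1}·T_k(ρ^res_k)` — the Introduction's transformations `T` of (2) (`RunObjects.T`, [4] (10)) applied
   with the all-plaquette small-field characteristic function `χ^δ_j = Setup.chiSmall univ (δ j)` inserted on EVERY
   level, for an arbitrary threshold profile `δ : ℕ → ℝ` (print's (40) profile is `delta40`); `rhoRes_nonneg`.  This is
   the object the cell's node N6a (K1-S, «on histories with no large field up to h⋆ the effective density is …») is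
   ABOUT: by `integral_rhoRes_mul` (§2) `ρ^res_k dV` IS the law of the `k`-fold averaged field `Ū^k` under the measure
   `ρ₀(U)·Π_{j≤k}χ^δ_j(Ū^j)·dU` — the Wilson measure RESTRICTED TO THE GOOD EVENT «all plaquette variables of all
   `j`-fold averages, `j ≤ k`, are `δ_j`-small» (`goodChi`), in the push-forward reading of `Setup.IsRT`.
§2 `integral_rhoRes_mul` — the push-forward identity, PROVED from `RTOpI.isRT` by induction on `k` (hypotheses: the
   averaging maps are measurable — the lane's binder C-2 `ExternalInputs.av_meas` —, and the restricted densities are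
   integrable — the form in which `RTOpI` asks it; `RegularGaugeGroup G` for the measurability of `χ^δ`).
§3 `Ineq41Restricted W δ k` / `Ineq47Restricted W δ k` — THE RESTRICTED READING of (41)/(47): the no-large-field term's
   two-sided bound ON `ρ^res_k` ITSELF, with the printed exponent of (47) (`SectBLowerBound.Ineq47Literal`'s tokens:
   main term, interaction sum at the trivial history, `−E_k`, `∓Rm_k`) — GAP-STATED on print (print states (41) for the
   full density and (47) for `ρ_k`; the restricted statements are what the inductive proof pp. 268–272 establishes for
   the `Ω_{k+1} = T_η` term), hypothesis-shaped, never asserted; `ineq47Literal_of_restricted` ((47) as printed ⇐ the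
   restricted lower bound + `ρ^res ≤ ρ` + the inclusion «(47)-domain ⊆ δ-domain»); THE SANDWICH `sandwich_of_restricted`:
   on the doubly-small domain `{χ_k = 1} ∩ {χ^δ_k = 1}` the restricted density is within `e^{±Rm_k}` of the EXPLICIT
   Gibbs factor `e^{−E_k}·exp[−(1/g_k²)A^η(U_k(V)) + Σ𝒫]` (log form `abs_log_rhoRes_sub_le`), and `sandwich_of_inclusion`:
   on the whole δ-domain GIVEN the threshold inclusion «δ_k-small field ⇒ (47)-small minimizer» — the cell's latent row
   G3D-09 made kernel-visible: at print's thresholds ((40): `2L²g_{k−1}p(g_{k−1})` on the field, (47): `g_kp(g_k)η²` on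
   the minimizer) [7] Thm 1 (8) p. 279 offers the inclusion only with its constant `B₃`, i.e. it needs
   `2L²B₃·g_{k−1}p(g_{k−1}) ≤ g_kp(g_k)`, which with `g_{k−1} = g_kL^{−1/2}` and `p` decreasing reads `2L^{3/2}B₃·
   p(g_{k−1})/p(g_k) ≤ 1` — not available for `L ≥ 2` unless `B₃ < ½L^{−3/2}`; matched thresholds are King's device
   (CMP 102 (1986) 649, Appendix p. 676), not [B10]'s.
§4 (sibling file `SectBRemainder.lean`) THE SIZE OF THE REMAINDER `Rm_k` — the log-radius of the sandwich: geometric in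
   the depth below the unit scale (`Rm_le_height`), with a `K`-independent floor AT the unit scale (`Rm_unit_floor`).
-/

namespace Literature.MathematicalPhysics.QuantumFieldTheory.Balaban1985CMP102.SectB.TowerObjects

open Literature.MathematicalPhysics.QuantumFieldTheory.Balaban1983to89
open Literature.MathematicalPhysics.QuantumFieldTheory.Balaban1985CMP102.Setting
open _root_.MeasureTheory

variable {L : ℕ} {S : Scales L} {G : Type} [Balaban1983to89.GaugeGroup G] [MeasurableSpace G]
  [Balaban1983to89.HaarData G] (W : TowerObjects S G)

/-! ## §0 Plumbing: the all-plaquette small-field factor `χ^δ` -/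

omit [MeasurableSpace G] [Balaban1983to89.HaarData G] in
/-- The all-plaquette small-field characteristic function `χ^δ(V) = χ({|V(∂p) − 1| < δ, p ⊂ T^{(j)}})` of level `j` at
threshold `δ` (`Setup.chiSmall Set.univ δ`; the shape of (4) p. 256 and of (40) p. 266 with `Λ_j` = the whole lattice).
[cite: Balaban1985UV3, (40) p.266] -/
noncomputable def chiAll (j : ℕ) (δ : ℝ) : Balaban1983to89.Density S.P j G :=
  Balaban1983to89.chiSmall Set.univ δ

omit [MeasurableSpace G] [Balaban1983to89.HaarData G] in
/-- `χ^δ(V) = 1` iff every plaquette variable of `V` is `δ`-small (`Setup.PlaqSmall δ V`), else `χ^δ(V) = 0`.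
One-line unfolding. [cite: Balaban1985UV3, (40) p.266] -/
theorem chiAll_eq_one_iff (j : ℕ) (δ : ℝ) (V : Balaban1983to89.GaugeField S.P j G) :
    chiAll (S := S) (G := G) j δ V = 1 ↔ Balaban1983to89.PlaqSmall δ V := by
  unfold chiAll Balaban1983to89.chiSmall Balaban1983to89.PlaqSmallOn Balaban1983to89.PlaqSmall
  simp only [Set.mem_univ, forall_const]
  split_ifs with h
  · exact ⟨fun _ => h, fun _ => rfl⟩
  · exact ⟨fun h0 => absurd h0 (by norm_num), fun h' => absurd h' h⟩

omit [MeasurableSpace G] [Balaban1983to89.HaarData G] in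
/-- Off the `δ`-small domain `χ^δ(V) = 0`. One-line unfolding. [cite: Balaban1985UV3, (40) p.266] -/
theorem chiAll_eq_zero_iff (j : ℕ) (δ : ℝ) (V : Balaban1983to89.GaugeField S.P j G) :
    chiAll (S := S) (G := G) j δ V = 0 ↔ ¬ Balaban1983to89.PlaqSmall δ V := by
  unfold chiAll Balaban1983to89.chiSmall Balaban1983to89.PlaqSmallOn Balaban1983to89.PlaqSmall
  simp only [Set.mem_univ, forall_const]
  split_ifs with h
  · exact ⟨fun h1 => absurd h1 (by norm_num), fun h' => absurd h h'⟩
  · exact ⟨fun _ => h, fun _ => rfl⟩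

omit [MeasurableSpace G] [Balaban1983to89.HaarData G] in
/-- `0 ≤ χ^δ`. [cite: Balaban1985UV3, (40) p.266] -/
theorem chiAll_nonneg (j : ℕ) (δ : ℝ) (V : Balaban1983to89.GaugeField S.P j G) :
    0 ≤ chiAll (S := S) (G := G) j δ V := by
  unfold chiAll Balaban1983to89.chiSmall
  split_ifs <;> norm_num

omit [MeasurableSpace G] [Balaban1983to89.HaarData G] in
/-- `χ^δ ≤ 1`. [cite: Balaban1985UV3, (40) p.266] -/
theorem chiAll_le_one (j : ℕ) (δ : ℝ) (V : Balaban1983to89.GaugeField S.P j G) :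
    chiAll (S := S) (G := G) j δ V ≤ 1 := by
  unfold chiAll Balaban1983to89.chiSmall
  split_ifs <;> norm_num

omit [MeasurableSpace G] [Balaban1983to89.HaarData G] in
/-- `|χ^δ| ≤ 1`. [cite: Balaban1985UV3, (40) p.266] -/
theorem abs_chiAll_le_one (j : ℕ) (δ : ℝ) (V : Balaban1983to89.GaugeField S.P j G) :
    |chiAll (S := S) (G := G) j δ V| ≤ 1 := by
  rw [abs_of_nonneg (chiAll_nonneg j δ V)]
  exact chiAll_le_one j δ V

omit [Balaban1983to89.HaarData G] in
/-- The plaquette variable `V ↦ V(∂p)` is measurable for the product structure (`RegularGaugeGroup`: measurable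
multiplication and inversion); re-derived here to keep the spine's imports light (the same four-factor computation as
LQB `Missing.measurable_plaqHol`). [folklore] -/
private theorem measurable_plaqHol' [Balaban1983to89.RegularGaugeGroup G] {j : ℕ} (p : Balaban1983to89.Plaq S.P j) :
    Measurable fun V : Balaban1983to89.GaugeField S.P j G => Balaban1983to89.GaugeField.plaqHol V p := by
  unfold Balaban1983to89.GaugeField.plaqHol
  have hev : ∀ b : Balaban1983to89.PBond S.P j,
      Measurable fun V : Balaban1983to89.GaugeField S.P j G => V b := fun b => measurable_pi_apply b
  exact (((hev _).mul (hev _)).mul (hev _).inv).mul (hev _).inv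

omit [Balaban1983to89.HaarData G] in
/-- The small-field characteristic function `χ^δ` of (40) p. 266 is measurable (`RegularGaugeGroup`: `dist1`
measurable; a finite intersection of measurable plaquette events); cf. LQB `T4AxialGaugeFixing.measurable_chiSmall`,
re-derived to keep the spine's imports light. [cite: Balaban1985UV3, (40) p.266] -/
theorem measurable_chiAll [Balaban1983to89.RegularGaugeGroup G] (j : ℕ) (δ : ℝ) :
    Measurable (chiAll (S := S) (G := G) j δ) := by
  unfold chiAll Balaban1983to89.chiSmall
  refine Measurable.ite ?_ measurable_const measurable_const
  have h : {V : Balaban1983to89.GaugeField S.P j G | Balaban1983to89.PlaqSmallOn Set.univ δ V} =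
      ⋂ p : Balaban1983to89.Plaq S.P j,
        {V | Balaban1983to89.dist1 (Balaban1983to89.GaugeField.plaqHol V p) < δ} := by
    ext V
    simp only [Balaban1983to89.PlaqSmallOn, Set.mem_univ, forall_const, Set.mem_setOf_eq, Set.mem_iInter]
  rw [h]
  exact MeasurableSet.iInter fun p =>
    measurableSet_lt (Balaban1983to89.RegularGaugeGroup.measurable_dist1.comp (measurable_plaqHol' p))
      measurable_const

/-! ## §1 The restricted densities `ρ^res_k` and the good-event factor -/

/-- **THE SMALL-FIELD-RESTRICTED DENSITIES** (the «no large fields» term of (41) p. 266 as an OBJECT): for a threshold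
profile `δ : ℕ → ℝ`, `ρ^res_0 := χ^{δ₀}·ρ₀` ((1) p. 256) and `ρ^res_{k+1} := χ^{δ_{k+1}}·T_k(ρ^res_k)`, `T_k` = the
transformation of (2) p. 256 L9–11 «ρ_{k+1} = Tρ_k. (2)» (`RunObjects.T k`, [4] (10) p. 19) — the densities obtained by
inserting, on every level `j ≤ k`, the all-plaquette small-field characteristic function at threshold `δ_j` (print's
profile (40) p. 266 L15–18 is `delta40`).  This is the integrand of the `Ω_{k+1} = T_η` term by which print proves (47)
(p. 272 L32–33 «The lower bound is proved in the same way, with all simplifications coming from the fact that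
Ω_{k+1} = T_η.»); DEFINED here, nothing asserted about it. [cite: Balaban1985UV3, (40)–(41) p.266 + (47) p.267] -/
noncomputable def rhoRes (δ : ℕ → ℝ) : (k : ℕ) → Balaban1983to89.Density S.P k G
  | 0 => fun U => chiAll 0 (δ 0) U * W.rho0 U
  | k + 1 => fun V => chiAll (k + 1) (δ (k + 1)) V * (W.T k).T (rhoRes δ k) V

/-- `ρ^res_0 = χ^{δ₀}·ρ₀` (definitional). [cite: Balaban1985UV3, (1) p.256] -/
theorem rhoRes_zero (δ : ℕ → ℝ) (U : Balaban1983to89.GaugeField S.P 0 G) :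
    W.rhoRes δ 0 U = chiAll 0 (δ 0) U * W.rho0 U := rfl

/-- `ρ^res_{k+1} = χ^{δ_{k+1}}·T_k(ρ^res_k)` (definitional). [cite: Balaban1985UV3, (2) p.256] -/
theorem rhoRes_succ (δ : ℕ → ℝ) (k : ℕ) (V : Balaban1983to89.GaugeField S.P (k + 1) G) :
    W.rhoRes δ (k + 1) V = chiAll (k + 1) (δ (k + 1)) V * (W.T k).T (W.rhoRes δ k) V := rfl

/-- `ρ^res_k ≥ 0`: `ρ₀ = exp(…) > 0`, characteristic functions are `≥ 0`, and `T` preserves positivity (`RTOpI.pos`).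
[cite: Balaban1985UV3, (1)–(2) p.256] -/
theorem rhoRes_nonneg (δ : ℕ → ℝ) : ∀ (k : ℕ) (V : Balaban1983to89.GaugeField S.P k G), 0 ≤ W.rhoRes δ k V
  | 0, V => by
      rw [rhoRes_zero]
      exact mul_nonneg (chiAll_nonneg 0 (δ 0) V) (by unfold RunObjects.rho0; exact Real.exp_nonneg _)
  | k + 1, V => by
      rw [rhoRes_succ]
      exact mul_nonneg (chiAll_nonneg (k + 1) (δ (k + 1)) V) ((W.T k).pos _ (rhoRes_nonneg δ k) V)

/-- `ρ^res_k` carries the top-level factor: off the `δ_k`-small domain of `V` it vanishes. [cite: Balaban1985UV3, (40) p.266] -/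
theorem rhoRes_eq_zero_of_not_small (δ : ℕ → ℝ) :
    ∀ (k : ℕ) (V : Balaban1983to89.GaugeField S.P k G), ¬ Balaban1983to89.PlaqSmall (δ k) V → W.rhoRes δ k V = 0
  | 0, V, hV => by rw [rhoRes_zero, (chiAll_eq_zero_iff 0 (δ 0) V).2 hV, zero_mul]
  | k + 1, V, hV => by rw [rhoRes_succ, (chiAll_eq_zero_iff (k + 1) (δ (k + 1)) V).2 hV, zero_mul]

/-- **THE GOOD-EVENT FACTOR** on the finest lattice: `Π_{j ≤ k} χ^{δ_j}(Ū^j)` — «all plaquette variables of all `j`-fold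
averages `Ū^j = Averaging.iter av j U`, `j ≤ k`, are `δ_j`-small» (the event the cell's K1/K2 nodes condition on, for
the averaging maps `av` of (2)). [cite: Balaban1985UV3, (38)–(40) p.266] -/
noncomputable def goodChi (δ : ℕ → ℝ) : (k : ℕ) → Balaban1983to89.GaugeField S.P 0 G → ℝ
  | 0 => fun U => chiAll 0 (δ 0) U
  | k + 1 => fun U => goodChi δ k U * chiAll (k + 1) (δ (k + 1)) (Balaban1983to89.Averaging.iter W.av (k + 1) U)

/-- `0 ≤ goodChi ≤ 1` (a product of characteristic functions): nonnegativity. [cite: Balaban1985UV3, (40) p.266] -/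
theorem goodChi_nonneg (δ : ℕ → ℝ) : ∀ (k : ℕ) (U : Balaban1983to89.GaugeField S.P 0 G), 0 ≤ W.goodChi δ k U
  | 0, U => chiAll_nonneg 0 (δ 0) U
  | k + 1, U => mul_nonneg (goodChi_nonneg δ k U) (chiAll_nonneg _ _ _)

/-- `goodChi ≤ 1`. [cite: Balaban1985UV3, (40) p.266] -/
theorem goodChi_le_one (δ : ℕ → ℝ) : ∀ (k : ℕ) (U : Balaban1983to89.GaugeField S.P 0 G), W.goodChi δ k U ≤ 1
  | 0, U => chiAll_le_one 0 (δ 0) U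
  | k + 1, U => mul_le_one₀ (goodChi_le_one δ k U) (chiAll_nonneg _ _ _) (chiAll_le_one _ _ _)

/-! ## §2 The push-forward identity: `ρ^res_k dV` is the law of `Ū^k` on the good event -/

/-- **`ρ^res_k` IS THE DENSITY OF THE `k`-FOLD AVERAGED FIELD ON THE GOOD EVENT** (push-forward reading of (2), [4] (10)
p. 19 «ρ′(V) = ∫dU δ(VŪ^{−1}) ρ(U)», iterated with the characteristic functions (40) inserted): for every bounded measurable
`f` on level `k`,
`∫ ρ^res_k(V)·f(V) dV = ∫ ρ₀(U)·Π_{j≤k}χ^{δ_j}(Ū^j)·f(Ū^k) dU`.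
PROVED by induction on `k` from `RTOpI.isRT` (the push-forward identity `Setup.IsRT` of each `T_j` on integrable densities),
under: the averaging maps are measurable (the lane pub-balaban3d's binder C-2 `ExternalInputs.av_meas`; automatic for
[4]'s smooth (15)), and the restricted densities are integrable for the product Haar measures (the form in which `RTOpI`
asks it; for bounded measurable `T`-images on the compact configuration space it is automatic).
[cite: Balaban1985UV3, (2) p.256 + (40)–(41) p.266; Balaban1985Averaging, (10) p.19] -/
theorem integral_rhoRes_mul [Balaban1983to89.RegularGaugeGroup G] (δ : ℕ → ℝ)
    (hav : ∀ j, Measurable (W.av j).avg)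
    (hint : ∀ j, Integrable (W.rhoRes δ j) (Balaban1983to89.fieldMeasure S.P j G)) :
    ∀ (k : ℕ) (f : Balaban1983to89.GaugeField S.P k G → ℝ), Measurable f → (∃ C : ℝ, ∀ V, |f V| ≤ C) →
      ∫ V, W.rhoRes δ k V * f V ∂(Balaban1983to89.fieldMeasure S.P k G)
        = ∫ U, W.rho0 U * W.goodChi δ k U * f (Balaban1983to89.Averaging.iter W.av k U)
            ∂(Balaban1983to89.fieldMeasure S.P 0 G)
  | 0, f, _, _ => by
      congr 1
      funext U
      simp only [rhoRes_zero, goodChi, Balaban1983to89.Averaging.iter, id]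
      ring
  | k + 1, f, hf, hC => by
      obtain ⟨C, hC⟩ := hC
      -- the test function one level down: `g(V) = χ^{δ_{k+1}}(V)·f(V)`, bounded by `C`, measurable
      have hg : Measurable fun V : Balaban1983to89.GaugeField S.P (k + 1) G => chiAll (k + 1) (δ (k + 1)) V * f V :=
        (measurable_chiAll (k + 1) (δ (k + 1))).mul hf
      have hgb : ∀ V : Balaban1983to89.GaugeField S.P (k + 1) G, |chiAll (k + 1) (δ (k + 1)) V * f V| ≤ C := by
        intro V
        rw [abs_mul]
        have h1 := abs_chiAll_le_one (S := S) (G := G) (k + 1) (δ (k + 1)) V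
        have h2 := hC V
        have h3 : 0 ≤ |f V| := abs_nonneg _
        nlinarith
      have step1 : ∫ V, W.rhoRes δ (k + 1) V * f V ∂(Balaban1983to89.fieldMeasure S.P (k + 1) G)
          = ∫ V, (W.T k).T (W.rhoRes δ k) V * (chiAll (k + 1) (δ (k + 1)) V * f V)
              ∂(Balaban1983to89.fieldMeasure S.P (k + 1) G) := by
        congr 1
        funext V
        rw [rhoRes_succ]
        ring
      have step2 : ∫ V, (W.T k).T (W.rhoRes δ k) V * (chiAll (k + 1) (δ (k + 1)) V * f V)
            ∂(Balaban1983to89.fieldMeasure S.P (k + 1) G)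
          = ∫ U, W.rhoRes δ k U * (chiAll (k + 1) (δ (k + 1)) ((W.av k).avg U) * f ((W.av k).avg U))
            ∂(Balaban1983to89.fieldMeasure S.P k G) :=
        (W.T k).isRT (W.rhoRes δ k) (hint k) (fun V => chiAll (k + 1) (δ (k + 1)) V * f V) hg ⟨C, hgb⟩
      have hg' : Measurable fun U : Balaban1983to89.GaugeField S.P k G =>
          chiAll (k + 1) (δ (k + 1)) ((W.av k).avg U) * f ((W.av k).avg U) := hg.comp (hav k)
      have step3 : ∫ U, W.rhoRes δ k U * (chiAll (k + 1) (δ (k + 1)) ((W.av k).avg U) * f ((W.av k).avg U))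
            ∂(Balaban1983to89.fieldMeasure S.P k G)
          = ∫ U, W.rho0 U * W.goodChi δ k U *
              (chiAll (k + 1) (δ (k + 1)) ((W.av k).avg (Balaban1983to89.Averaging.iter W.av k U)) *
                f ((W.av k).avg (Balaban1983to89.Averaging.iter W.av k U)))
            ∂(Balaban1983to89.fieldMeasure S.P 0 G) :=
        integral_rhoRes_mul δ hav hint k _ hg' ⟨C, fun U => hgb _⟩
      rw [step1, step2, step3]
      congr 1
      funext U
      simp only [goodChi, Balaban1983to89.Averaging.iter, Function.comp]
      ring

/-- **Total mass**: the restricted partition function `∫ ρ^res_k dV` equals the `ρ₀ dU`-mass of the good event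
`∫ ρ₀·Π_{j≤k}χ^{δ_j}(Ū^j) dU` (`integral_rhoRes_mul` at `f = 1`). [cite: Balaban1985UV3, (6) p.257 + (40) p.266] -/
theorem integral_rhoRes [Balaban1983to89.RegularGaugeGroup G] (δ : ℕ → ℝ)
    (hav : ∀ j, Measurable (W.av j).avg)
    (hint : ∀ j, Integrable (W.rhoRes δ j) (Balaban1983to89.fieldMeasure S.P j G)) (k : ℕ) :
    ∫ V, W.rhoRes δ k V ∂(Balaban1983to89.fieldMeasure S.P k G)
      = ∫ U, W.rho0 U * W.goodChi δ k U ∂(Balaban1983to89.fieldMeasure S.P 0 G) := by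
  have h := W.integral_rhoRes_mul δ hav hint k (fun _ => 1) measurable_const ⟨1, fun _ => by simp⟩
  simpa using h

/-! ## §3 The restricted reading of (41)/(47), the (47)-bridge, and the sandwich -/

/-- The EXPLICIT part of the exponent of (41)/(47) at the history without large fields: `−(1/g_k²)A^η(U_k(V)) +
Σ_{j=1}^k Σ_{Y_j} 𝒫_j(Y_j, U_k)` — the tokens of `SectB.ineq47AsPrinted_iff` / `SectBLowerBound.Ineq47Literal` (main term
`(S.gk k)⁻¹²·S.actionEta k (U_k)`, interaction sum `Pint k (triv k)`), WITHOUT the constants `−E_k`, `∓Rm_k`.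
[cite: Balaban1985UV3, (41) p.266 + (47) p.267] -/
noncomputable def explicitExpo (k : ℕ) (V : Balaban1983to89.GaugeField S.P k G) : ℝ :=
  -((S.gk k)⁻¹ ^ 2 * S.actionEta k (W.UkH k (W.triv k) V)) + W.Pint k (W.triv k) V

/-- **THE RESTRICTED READING OF (41), upper half** — GAP-STATED on print, hypothesis-shaped, never asserted: the
restricted density is bounded by the no-large-field term of (41) p. 266, `ρ^res_k(V) ≤ χ^{δ_k}(V)·exp[−(1/g_k²)A^η(U_k(V))
+ Σ𝒫 − E_k + Σ_{j<k}O((L^jε)^{3+κ₀})|T₁^{(j)}|]` (print states (41) for the FULL density as a sum over all histories; its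
inductive proof pp. 268–272 bounds the histories one by one, and this is the bound of the history `Ω_1 = ⋯ = Ω_{k} = T_η`
— what the cell's node N6a consumes). [cite: Balaban1985UV3, (41) p.266] -/
def Ineq41Restricted (δ : ℕ → ℝ) (k : ℕ) : Prop :=
  ∀ V : Balaban1983to89.GaugeField S.P k G,
    W.rhoRes δ k V ≤ chiAll k (δ k) V * Real.exp (W.explicitExpo k V - W.Ecst k + W.Rm k)

/-- **THE RESTRICTED READING OF (47), lower half** — hypothesis-shaped, never asserted: (47) p. 267 L17–20 as a lower bound
for the RESTRICTED density (which is how print proves it, p. 272 L32–33: every dropped large-field contribution is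
nonnegative), with print's own `χ_k` («|U_k(∂p) − 1| < g_kp(g_k)η², p ⊂ T_η», `SectBLowerBound.chi47`) times the
definitional top-level factor `χ^{δ_k}`: `χ_k(V)·χ^{δ_k}(V)·exp[−(1/g_k²)A^η(U_k(V)) + Σ𝒫 − E_k − Σ_{j<k}O((L^jε)^{3+κ₀})
|T₁^{(j)}|] ≤ ρ^res_k(V)`. [cite: Balaban1985UV3, (47) p.267 + p.272 L32–33] -/
def Ineq47Restricted (δ : ℕ → ℝ) (k : ℕ) : Prop :=
  ∀ V : Balaban1983to89.GaugeField S.P k G,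
    W.chi47 k V * chiAll k (δ k) V * Real.exp (W.explicitExpo k V - W.Ecst k - W.Rm k) ≤ W.rhoRes δ k V

/-- **(47) AS PRINTED ⇐ the restricted lower bound**, given that the restricted density lies below the full one
(`ρ^res_k ≤ ρ_k`: dropped contributions are nonnegative — for the positive LINEAR `T` of [4] (10) it is monotonicity of
`T`; a hypothesis here since `Setup.RTOpI` records positivity only) and the threshold inclusion «(47)-domain ⊆
δ_k-domain» (so that `χ_k·χ^{δ_k} = χ_k`; at print's thresholds this is the [4] Prop 2 (54) p. 26 direction,
`SectBLowerBound.Chi47SubChi4`'s shape).  Bookkeeping. [cite: Balaban1985UV3, (47) p.267] -/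
theorem ineq47Literal_of_restricted (δ : ℕ → ℝ) (k : ℕ) (h : W.Ineq47Restricted δ k)
    (hle : ∀ V, W.rhoRes δ k V ≤ W.rho k V)
    (hincl : ∀ V, W.Chi47Restriction k V → Balaban1983to89.PlaqSmall (δ k) V) :
    W.Ineq47Literal k := by
  intro V
  by_cases hV : W.Chi47Restriction k V
  · have h1 : chiAll k (δ k) V = 1 := (chiAll_eq_one_iff k (δ k) V).2 (hincl V hV)
    have h2 := h V
    rw [h1, mul_one] at h2
    exact h2.trans (hle V)
  · rw [(W.chi47_eq_zero_iff k V).2 hV, zero_mul]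
    have h0 := W.rhoRes_nonneg δ k V
    linarith [hle V]

/-- **THE SANDWICH ON THE DOUBLY-SMALL DOMAIN**: under the restricted reading of (41)/(47), for every `V` with
`χ_k(V) = 1` (print's (47)-restriction on the minimizer) AND `χ^{δ_k}(V) = 1` (small field), the restricted density is
within `e^{±Rm_k}` of the explicit Gibbs factor: `e^{−E_k − Rm_k}·e^{F(V)} ≤ ρ^res_k(V) ≤ e^{−E_k + Rm_k}·e^{F(V)}`,
`F = explicitExpo` — the shape «two-sided domination with constant `e^{−E_k}` and log-radius `Rm_k`» of the cell's K1-S.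
Bookkeeping over the two hypotheses. [cite: Balaban1985UV3, (41) p.266 + (47) p.267] -/
theorem sandwich_of_restricted (δ : ℕ → ℝ) (k : ℕ) (h41 : W.Ineq41Restricted δ k) (h47 : W.Ineq47Restricted δ k)
    (V : Balaban1983to89.GaugeField S.P k G) (hχ : W.Chi47Restriction k V)
    (hδ : Balaban1983to89.PlaqSmall (δ k) V) :
    Real.exp (-W.Ecst k - W.Rm k) * Real.exp (W.explicitExpo k V) ≤ W.rhoRes δ k V ∧
      W.rhoRes δ k V ≤ Real.exp (-W.Ecst k + W.Rm k) * Real.exp (W.explicitExpo k V) := by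
  have h1 : chiAll k (δ k) V = 1 := (chiAll_eq_one_iff k (δ k) V).2 hδ
  have h2 : W.chi47 k V = 1 := (W.chi47_eq_one_iff k V).2 hχ
  have hu := h41 V
  have hl := h47 V
  rw [h1, one_mul] at hu
  rw [h1, h2, one_mul, one_mul] at hl
  constructor
  · rw [← Real.exp_add]
    convert hl using 2
    ring
  · rw [← Real.exp_add]
    convert hu using 2
    ring

/-- Log form of the sandwich: on the doubly-small domain `|log ρ^res_k(V) − F(V) + E_k| ≤ Rm_k`.
[cite: Balaban1985UV3, (41) p.266 + (47) p.267] -/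
theorem abs_log_rhoRes_sub_le (δ : ℕ → ℝ) (k : ℕ) (h41 : W.Ineq41Restricted δ k) (h47 : W.Ineq47Restricted δ k)
    (V : Balaban1983to89.GaugeField S.P k G) (hχ : W.Chi47Restriction k V)
    (hδ : Balaban1983to89.PlaqSmall (δ k) V) :
    |Real.log (W.rhoRes δ k V) - W.explicitExpo k V + W.Ecst k| ≤ W.Rm k := by
  obtain ⟨hl, hu⟩ := W.sandwich_of_restricted δ k h41 h47 V hχ hδ
  rw [← Real.exp_add] at hl hu
  have hpos : 0 < W.rhoRes δ k V := lt_of_lt_of_le (Real.exp_pos _) hl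
  have hl' := Real.log_le_log (Real.exp_pos _) hl
  have hu' := Real.log_le_log hpos hu
  rw [Real.log_exp] at hl' hu'
  rw [abs_le]
  constructor <;> linarith

/-- **THE SANDWICH ON THE WHOLE SMALL-FIELD DOMAIN, GIVEN THE THRESHOLD INCLUSION** «`δ_k`-small field ⇒ (47)-small
minimizer» (`PlaqSmall (δ k) V → Chi47Restriction k V`; the shape of `SectBLowerBound.Chi4SubChi47` at threshold `δ_k`):
then the two-sided bound holds for EVERY `δ_k`-small `V`, i.e. on the full support of `ρ^res_k` — the form a K1-S
domination of the good-event law needs (on `{χ^{δ_k} = 1, χ_k = 0}` the restricted reading gives no lower bound).  The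
inclusion is the cell's latent row G3D-09 at these thresholds: for print's (40) profile `δ_k = 2L²g_{k−1}p(g_{k−1})` [7]
Thm 1 (8) p. 279 delivers «minimizer plaquettes `< B₃δ_kη²`», so it needs `2L²B₃g_{k−1}p(g_{k−1}) ≤ g_kp(g_k)`, not stated
in [B10]; hypothesis here, never asserted. [cite: Balaban1985UV3, (40) p.266 + (47) p.267; Balaban1985Variational, Thm 1 (8) p.279] -/
theorem sandwich_of_inclusion (δ : ℕ → ℝ) (k : ℕ) (h41 : W.Ineq41Restricted δ k) (h47 : W.Ineq47Restricted δ k)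
    (hincl : ∀ V, Balaban1983to89.PlaqSmall (δ k) V → W.Chi47Restriction k V)
    (V : Balaban1983to89.GaugeField S.P k G) (hδ : Balaban1983to89.PlaqSmall (δ k) V) :
    Real.exp (-W.Ecst k - W.Rm k) * Real.exp (W.explicitExpo k V) ≤ W.rhoRes δ k V ∧
      W.rhoRes δ k V ≤ Real.exp (-W.Ecst k + W.Rm k) * Real.exp (W.explicitExpo k V) :=
  W.sandwich_of_restricted δ k h41 h47 V (hincl V hδ) hδ

/-- **Print's threshold profile (40)** p. 266 L15–18, verbatim (render p012): «χ_j = Π_{p∈Λ_j} χ({|V_j(∂p) − 1| <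
2L²g_{j−1}p(g_{j−1})}), j = 1, …, k, (40) where we have denoted V_k = V.» — `δ_j = 2L²·g_{j−1}·p(g_{j−1})` with `p` =
`B10.pFun b₀ p₀` of (7), `g_{j−1}` = `Scales.gk (j − 1)` (truncated subtraction at `j = 0`, where print imposes no
(40)-restriction; the convention of `SectB.Reg44AsPrinted`). [cite: Balaban1985UV3, (40) p.266] -/
noncomputable def delta40 (j : ℕ) : ℝ :=
  2 * (L : ℝ) ^ 2 * (S.gk (j - 1) * Balaban1983to89.B10.pFun W.b₀ W.p₀ (S.gk (j - 1)))

end Literature.MathematicalPhysics.QuantumFieldTheory.Balaban1985CMP102.SectB.TowerObjects
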